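import Summits.NavierStokesRegularity.NavierStokesRegularity.Theorems.SqueezeCycleMustSqueezeAlgebra

/-!
# Crux `MustSqueeze` (stmt-NavierStokesRegularity-11610), negative side: negative thresholds

Negative-side (cdisprove gen 4, D-0016) support lemmas extracted from `Cruxes/MustSqueeze/Disproof.lean`
v11 §9, importable.  Pure `sl(3)` eigenvalue algebra behind the engine's pointwise production law
`ω·Sω = 4 det ∇u − 4 det S`, `−4 det S ≤ c(a)·a·|S|²` under the squeeze `λ₂(S) ≤ a`:

* `production_le_fourThirds_middle_of_nonpos` — for an ordered trace-free triple with `λ₂ ≤ 0`: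
  `−4λ₁λ₂λ₃ ≤ (4/3)λ₂(λ₁²+λ₂²+λ₃²)` (remainder `(4/3)λ₂(2λ₂+λ₃)(λ₂−λ₃) ≥ 0`);
* `production_le_fourThirds_of_middle_le` — hence `λ₂ ≤ a ≤ 0 ⇒ −4 det S ≤ (4/3)a|S|²`;
* `production_fourThirds_attained` — equality at the axisymmetric compression `(−2a, a, a)`;
* `not_production_le_two_middle_of_neg` — Miller's constant-`2` form (`Theorems.neg_det_half_add_transpose_le`
  shape, valid for `λ₂⁺`) is FALSE with `a < 0` in place of `λ₂⁺`: at `(−2a, a, a)`, `8a³ > 12a³`.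
  This is the algebraic content of the hypothesis `0 ≤ a` of the lead's `stub_signedBudget`
  (line outward-drift-signed-flux): below zero the honest damping is `2(¼ − (2/3)a)`, not `2(¼ − a)`;
* `production_le_of_middle_le` — both regimes at once with constant `max (2a) ((4/3)a)`.

Harmless for the crux itself (`a = 1/8 > 0`); `MustSqueezeAt a` for `a < 0` is weaker than `MustSqueezeAt 0`
(`Negative.Reductions.mustSqueezeAt_antitone`).  Nothing here closes the item (`--supports`).
-/

noncomputable section

namespace Summit.NavierStokesRegularity.NavierStokesRegularity.Theorems.MustSqueeze.Negative

/-! ## §9 Negative thresholds: below `a = 0` the sharp Miller constant is `4/3`, not `2`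
(the lever's hypothesis `0 ≤ a`, at the level of the pointwise algebra) -/

/-- **The `4/3`-law for a non-positive middle eigenvalue.** For an ordered trace-free triple
`λ₁ ≥ λ₂ ≥ λ₃` with `λ₂ ≤ 0`: `−4λ₁λ₂λ₃ ≤ (4/3)·λ₂·(λ₁² + λ₂² + λ₃²)`.  (Exact remainder:
`RHS − LHS = (4/3)·λ₂(2λ₂ + λ₃)(λ₂ − λ₃) ≥ 0`.)  So once the squeeze pushes `λ₂` BELOW zero
the local production is not merely `≤ 0` (which is all that `production_le_two_middle` gives,
its right-hand side being `2λ₂⁺|S|² = 0`) but negative, of size `(4/3)|λ₂||S|²`. -/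
theorem production_le_fourThirds_middle_of_nonpos (l₁ l₂ l₃ : ℝ) (h12 : l₂ ≤ l₁) (h23 : l₃ ≤ l₂)
    (htr : l₁ + l₂ + l₃ = 0) (h2 : l₂ ≤ 0) :
    -4 * (l₁ * l₂ * l₃) ≤ (4 / 3) * l₂ * (l₁ ^ 2 + l₂ ^ 2 + l₃ ^ 2) := by
  have h1 : l₁ = -(l₂ + l₃) := by linarith
  subst h1
  have key : 0 ≤ (-l₂) * (-(2 * l₂ + l₃)) * (l₂ - l₃) :=
    mul_nonneg (mul_nonneg (by linarith) (by linarith)) (by linarith)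
  nlinarith [key]

/-- Hence, under a NEGATIVE threshold `λ₂ ≤ a ≤ 0`: `−4 det S ≤ (4/3)·a·|S|²`. -/
theorem production_le_fourThirds_of_middle_le {a : ℝ} (ha : a ≤ 0) (l₁ l₂ l₃ : ℝ) (h12 : l₂ ≤ l₁)
    (h23 : l₃ ≤ l₂) (htr : l₁ + l₂ + l₃ = 0) (h2a : l₂ ≤ a) :
    -4 * (l₁ * l₂ * l₃) ≤ (4 / 3) * a * (l₁ ^ 2 + l₂ ^ 2 + l₃ ^ 2) := by
  have h := production_le_fourThirds_middle_of_nonpos l₁ l₂ l₃ h12 h23 htr (h2a.trans ha)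
  have hS : 0 ≤ l₁ ^ 2 + l₂ ^ 2 + l₃ ^ 2 := by positivity
  nlinarith [mul_le_mul_of_nonneg_right h2a hS]

/-- **`4/3` is attained** at the axisymmetric-compression triple `(−2a, a, a)` (two equal
compressive eigenvalues — the strain of a Burgers-vortex core, `λ = (α, −α/2, −α/2)`), for every
`a`: equality in `production_le_fourThirds_middle_of_nonpos`. -/
theorem production_fourThirds_attained (a : ℝ) :
    -4 * ((-2 * a) * a * a) = (4 / 3) * a * ((-2 * a) ^ 2 + a ^ 2 + a ^ 2) := by
  ring

/-- **The constant-`2` form is FALSE for negative thresholds.** For every `a < 0` the ordered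
trace-free triple `(−2a, a, a)` has `λ₂ = a`, yet `−4λ₁λ₂λ₃ = 8a³ > 12a³ = 2a|S|²`.  So the
bound "`λ₂ ≤ a ⇒ −4 det S ≤ 2a|S|²`" — which is what the lever's budget
`Z' ≤ −2(¼ − a)Z + K` would need pointwise for `a < 0` — fails; the honest damping below zero is
`2(¼ − (2/3)a)`, from the `4/3`-law.  This is the algebraic content of the hypothesis `0 ≤ a` in
`stub_signedBudget` (harmless for the crux, `a = 1/8`; and `MustSqueezeAt a` for `a < 0` is
anyway WEAKER than `MustSqueezeAt 0`, `mustSqueezeAt_antitone`). -/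
theorem not_production_le_two_middle_of_neg {a : ℝ} (ha : a < 0) :
    a ≤ -2 * a ∧ a ≤ a ∧ (-2 * a) + a + a = 0 ∧
      ¬ (-4 * ((-2 * a) * a * a) ≤ 2 * a * ((-2 * a) ^ 2 + a ^ 2 + a ^ 2)) := by
  refine ⟨by linarith, le_rfl, by ring, fun h => ?_⟩
  have h3 : a * (a * a) < 0 := mul_neg_of_neg_of_pos ha (mul_pos_of_neg_of_neg ha ha)
  nlinarith [h3]

/-- The two regimes side by side: the sharp pointwise constant `c(a)` in
"`λ₂ ≤ a ⇒ −4 det S ≤ c(a)·a·|S|²`" is `2` for `a ≥ 0` (`production_le_two_middle`,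
`production_const_sharp`) and `4/3` for `a ≤ 0` (this section); both vanish continuously at
`a = 0`, where the squeeze yields exactly Leray's free damping `¼` and nothing more. -/
theorem production_le_of_middle_le (a l₁ l₂ l₃ : ℝ) (h12 : l₂ ≤ l₁) (h23 : l₃ ≤ l₂)
    (htr : l₁ + l₂ + l₃ = 0) (h2a : l₂ ≤ a) :
    -4 * (l₁ * l₂ * l₃) ≤ max (2 * a) ((4 / 3) * a) * (l₁ ^ 2 + l₂ ^ 2 + l₃ ^ 2) := by
  have hS : 0 ≤ l₁ ^ 2 + l₂ ^ 2 + l₃ ^ 2 := by positivity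
  rcases le_or_gt a 0 with ha | ha
  · have h := production_le_fourThirds_of_middle_le ha l₁ l₂ l₃ h12 h23 htr h2a
    exact h.trans (mul_le_mul_of_nonneg_right (le_max_right _ _) hS)
  · rcases le_or_gt 0 l₂ with h2 | h2
    · have h3 : l₃ = -(l₁ + l₂) := by linarith
      subst h3
      have h1 : 0 ≤ l₁ := le_trans h2 h12
      have hS' : 0 ≤ l₁ ^ 2 + l₂ ^ 2 + (-(l₁ + l₂)) ^ 2 := by positivity
      have hmain : -4 * (l₁ * l₂ * -(l₁ + l₂)) ≤ 2 * l₂ * (l₁ ^ 2 + l₂ ^ 2 + (-(l₁ + l₂)) ^ 2) := by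
        nlinarith [mul_nonneg h1 h2, mul_nonneg (mul_nonneg h1 h2) h1, mul_nonneg (mul_nonneg h1 h2) h2]
      calc -4 * (l₁ * l₂ * -(l₁ + l₂)) ≤ 2 * l₂ * (l₁ ^ 2 + l₂ ^ 2 + (-(l₁ + l₂)) ^ 2) := hmain
        _ ≤ 2 * a * (l₁ ^ 2 + l₂ ^ 2 + (-(l₁ + l₂)) ^ 2) := by
          nlinarith [mul_le_mul_of_nonneg_right h2a hS']
        _ ≤ max (2 * a) ((4 / 3) * a) * (l₁ ^ 2 + l₂ ^ 2 + (-(l₁ + l₂)) ^ 2) :=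
          mul_le_mul_of_nonneg_right (le_max_left _ _) hS'
    · have h := production_le_fourThirds_middle_of_nonpos l₁ l₂ l₃ h12 h23 htr h2.le
      have h4 : (4 / 3) * l₂ * (l₁ ^ 2 + l₂ ^ 2 + l₃ ^ 2) ≤ 0 := by
        have : (4 / 3) * l₂ ≤ 0 := by linarith
        exact mul_nonpos_of_nonpos_of_nonneg this hS
      have h5 : 0 ≤ max (2 * a) ((4 / 3) * a) * (l₁ ^ 2 + l₂ ^ 2 + l₃ ^ 2) :=
        mul_nonneg (le_max_of_le_left (by linarith)) hS
      linarith

end Summit.NavierStokesRegularity.NavierStokesRegularity.Theorems.MustSqueeze.Negative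

end
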